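import Summits.MatrixMultiplication.MatrixMultiplication.Theorems.NilpotentLieHostsUnitriangularCostShapeModelRecipes
import Summits.MatrixMultiplication.MatrixMultiplication.Theses.NilpotentLieHosts

/-!
# `UnitriangularCostShape` — stub `stub_productModel` (line `registered`): the Weyl-type product model

Crux `stmt-MatrixMultiplication-7724` (`NilpotentLieHosts.UnitriangularCostShape`, card C2 of the route), line
`registered` = `Cruxes/UnitriangularCostShape/Lines/birth.lean`.  This file proves the load-bearing stub
`stub_productModel` BY NAME AND SIGNATURE: for every `d ≥ 3` there are `b > 0` (here `b = ⌊d/2⌋`, the index of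
`u_d`), `k = ⌊d/2⌋` Casimir variables and `c = d^{q+k}` (`q` = number of `q`-variables of the model,
`2q + k = d(d-1)/2`) such that every budget `s` admits `t = (d-1)s + 1`, `N = t^q ≤ c (s+1)^{(D-b)/2}`,
`t^k ≤ c (s+1)^b`, a map `ρ : SL_d(ℤ) → M_N(ℂ[z_1..z_k]/(z_i^t))` and, for every polynomial `p` of
`(j-i)`-weighted degree `≤ s`, a `ℂ`-linear functional `ℓ` with `ℓ (ρ g · ρ h) = p(g h)` for all upper
unitriangular `g, h`.

Construction (parts 1–11, `…Theorems.UnitriangularCostShape.ProductModel`): the polynomial Kirillov family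
("oscillator tower") of `U_d` on `ℂ[v_{(i,j)} : i < j, i + j + 1 ≥ d]` truncated at weight `T = (d-1)s`,
`π_T(g) f = exp(n_g) · σ_g(f)` (`σ_g` substitutes column-wise by the blocks of `g`, `n_g` is the last-column linear
form); the group law is interval-block matrix multiplication; faithfulness up to weight `s` is the span theorem
`main_span` (level theorem + induction on the level and on the row-degree); `W_T` is generated over the truncated
Casimir ring `R_t = ℂ[z_r]/(z_r^t)` (`z_r = v_{(r,d-1-r)}`) by the `q`-monomials, and `ρ(g)` is any lift of `π_T(g)`
to `R_t^N` (`phi_mulVec`), read through `phi` and the coefficient functionals.  No multiplicativity of `ρ` itself is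
claimed or needed.  Sources: Kirillov's orbit method for `U_n` (generic orbits through anti-diagonal forms),
Dixmier (quotients of `U(g)` by primitive ideals are Weyl algebras, `g` nilpotent); the graded/truncated version
here is proved from scratch.
-/

set_option linter.dupNamespace false

noncomputable section

namespace Summit.MatrixMultiplication.MatrixMultiplication.Theorems.UnitriangularCostShape

open MvPolynomial ProductModel
open scoped BigOperators

/-- **The product model, explicit exponents** (`b = k = ⌊d/2⌋`, `c = d^{q+k}`, `t = (d-1)s+1`,
`N = t^q`): the data of `stub_productModel` with the Casimir count made explicit (used again at `d = 3`). -/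
theorem productModel_explicit (d : ℕ) (hd : 3 ≤ d) : ∃ c : ℝ, 0 < c ∧ ∀ s : ℕ, ∃ t N : ℕ,
      (N : ℝ) ≤ c * ((s : ℝ) + 1) ^ (((d : ℝ) * (d - 1) / 2 - (d / 2 : ℕ)) / 2) ∧
      (t : ℝ) ^ (d / 2) ≤ c * ((s : ℝ) + 1) ^ ((d / 2 : ℕ) : ℝ) ∧
      ∃ ρ : Matrix.SpecialLinearGroup (Fin d) ℤ →
          Matrix (Fin N) (Fin N) (MvPolynomial (Fin (d / 2)) ℂ ⧸
            Ideal.span (Set.range fun i : Fin (d / 2) => (MvPolynomial.X i : MvPolynomial (Fin (d / 2)) ℂ) ^ t)),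
        ∀ p : MvPolynomial (Fin d × Fin d) ℂ,
          MvPolynomial.weightedTotalDegree (fun ij : Fin d × Fin d => (ij.2 : ℕ) - ij.1) p ≤ s →
          ∃ ℓ : Matrix (Fin N) (Fin N) (MvPolynomial (Fin (d / 2)) ℂ ⧸
              Ideal.span (Set.range fun i : Fin (d / 2) => (MvPolynomial.X i : MvPolynomial (Fin (d / 2)) ℂ) ^ t))
              →ₗ[ℂ] ℂ,
            ∀ g h : Matrix.SpecialLinearGroup (Fin d) ℤ,
              (∀ i j : Fin d, j ≤ i → (g : Matrix (Fin d) (Fin d) ℤ) i j = if i = j then 1 else 0) →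
              (∀ i j : Fin d, j ≤ i → (h : Matrix (Fin d) (Fin d) ℤ) i j = if i = j then 1 else 0) →
              ℓ (ρ g * ρ h) = MvPolynomial.eval (fun ij : Fin d × Fin d =>
                (((g * h : Matrix.SpecialLinearGroup (Fin d) ℤ) : Matrix (Fin d) (Fin d) ℤ) ij.1 ij.2 : ℂ)) p := by
  have hd1 : (1 : ℝ) ≤ d := by exact_mod_cast (show 1 ≤ d by omega)
  set q : ℕ := Fintype.card (QIdx d) with hq
  refine ⟨(d : ℝ) ^ (q + d / 2), by positivity, fun s => ?_⟩
  set T : ℕ := (d - 1) * s with hT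
  have hcount : 2 * (q : ℝ) + (d / 2 : ℕ) ≤ (d : ℝ) * (d - 1) / 2 := by
    have h := two_mul_card_qidx_add_le d
    have h' : ((2 * Fintype.card (QIdx d) + d / 2 : ℕ) : ℝ) ≤ (d.choose 2 : ℕ) := by exact_mod_cast h
    rw [Nat.cast_choose_two] at h'
    push_cast at h'
    exact h'
  have hs1 : (1 : ℝ) ≤ (s : ℝ) + 1 := by
    have : (0 : ℝ) ≤ s := Nat.cast_nonneg s
    linarith
  have hT1 : ((T + 1 : ℕ) : ℝ) ≤ (d : ℝ) * ((s : ℝ) + 1) := by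
    rw [hT]; push_cast [Nat.cast_sub (show 1 ≤ d by omega)]
    have : (0 : ℝ) ≤ s := Nat.cast_nonneg s
    nlinarith
  refine ⟨T + 1, Fintype.card (Idx d T), ?_, ?_, fun g => rho T (T + 1) (cmat g), fun p hp => ?_⟩
  · -- `N ≤ c (s+1)^((D - b)/2)`
    rw [card_Idx]
    have h1 : (((T + 1) ^ q : ℕ) : ℝ) ≤ ((d : ℝ) * ((s : ℝ) + 1)) ^ q := by
      rw [Nat.cast_pow]
      exact pow_le_pow_left₀ (by positivity) hT1 q
    have h2 : ((s : ℝ) + 1) ^ q ≤ ((s : ℝ) + 1) ^ (((d : ℝ) * (d - 1) / 2 - (d / 2 : ℕ)) / 2) := by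
      rw [← Real.rpow_natCast]
      exact Real.rpow_le_rpow_of_exponent_le hs1 (by linarith)
    have h3 : (d : ℝ) ^ q ≤ (d : ℝ) ^ (q + d / 2) := pow_le_pow_right₀ hd1 (Nat.le_add_right _ _)
    calc (((T + 1) ^ q : ℕ) : ℝ) ≤ ((d : ℝ) * ((s : ℝ) + 1)) ^ q := h1
      _ = (d : ℝ) ^ q * ((s : ℝ) + 1) ^ q := mul_pow _ _ _
      _ ≤ (d : ℝ) ^ (q + d / 2) * ((s : ℝ) + 1) ^ (((d : ℝ) * (d - 1) / 2 - (d / 2 : ℕ)) / 2) :=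
        mul_le_mul h3 h2 (by positivity) (by positivity)
  · -- `t^k ≤ c (s+1)^b`
    rw [Real.rpow_natCast]
    have h3 : (d : ℝ) ^ (d / 2) ≤ (d : ℝ) ^ (q + d / 2) := pow_le_pow_right₀ hd1 (Nat.le_add_left _ _)
    calc (((T + 1 : ℕ) : ℝ)) ^ (d / 2) ≤ ((d : ℝ) * ((s : ℝ) + 1)) ^ (d / 2) :=
        pow_le_pow_left₀ (by positivity) hT1 _
      _ = (d : ℝ) ^ (d / 2) * ((s : ℝ) + 1) ^ (d / 2) := mul_pow _ _ _
      _ ≤ (d : ℝ) ^ (q + d / 2) * ((s : ℝ) + 1) ^ (d / 2) :=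
        mul_le_mul_of_nonneg_right h3 (by positivity)
  · -- the reading functional
    obtain ⟨n, f, α, γ, hα, hwα, hwγ, hred⟩ := exists_recipe (d := d) (by omega) s p hp
    have hγ : ∀ i, Finsupp.weight Var.wt (γ i) ≤ T := fun i => hwγ i
    have hαT : ∀ i (u : QIdx d), α i u.1 < T + 1 := fun i u =>
      Nat.lt_succ_of_le ((Finsupp.le_weight Var.wt (s := u.1)
        (by have := u.1.one_le_wt; omega) (α i)).trans (hwα i))
    let a : Fin n → Idx d T := fun i u => ⟨α i u.1, hαT i u⟩
    have ha : ∀ i, toExp (a i) = α i := by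
      intro i; ext u
      rw [toExp_apply]
      split_ifs with hu
      · rfl
      · by_contra h'
        exact hu (hα i u (Finsupp.mem_support_iff.mpr (Ne.symm h')))
    refine ⟨ell T f γ hγ a, fun g h hg hh => ?_⟩
    have hcg := cmat_ut hg
    have hch := cmat_ut hh
    have hgh : ∀ i j : Fin d, j ≤ i →
        ((g * h : Matrix.SpecialLinearGroup (Fin d) ℤ) : Matrix (Fin d) (Fin d) ℤ) i j = if i = j then 1 else 0 := by
      -- product of unitriangular integer matrices is unitriangular
      intro i j hji
      rw [Matrix.SpecialLinearGroup.coe_mul, Matrix.mul_apply]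
      by_cases hij : i = j
      · subst hij
        rw [Finset.sum_eq_single i]
        · simp [hg i i le_rfl, hh i i le_rfl]
        · intro k _ hk
          rcases lt_or_gt_of_ne hk with h1 | h1
          · rw [hg i k h1.le]; simp [ne_of_gt h1]
          · rw [hh k i h1.le]; simp [ne_of_gt h1]
        · intro h1; exact absurd (Finset.mem_univ i) h1
      · rw [if_neg hij]
        refine Finset.sum_eq_zero fun k _ => ?_
        have hji' : j < i := lt_of_le_of_ne hji (Ne.symm hij)
        by_cases hk : k < i
        · rw [hg i k hk.le]; simp [ne_of_gt hk]
        · push Not at hk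
          have : j < k := lt_of_lt_of_le hji' hk
          rw [hh k j this.le]; simp [ne_of_gt this]
    have hcgh : ∀ i j : Fin d, j ≤ i → (cmat g * cmat h) i j = if i = j then 1 else 0 := by
      rw [← cmat_mul]; exact cmat_ut hgh
    -- evaluate the functional
    have key : ∀ i, coeffQ T (γ i) (hγ i)
        (phi T ((rho T (T + 1) (cmat g) * rho T (T + 1) (cmat h)).mulVec
          (Pi.single (Fintype.equivFin (Idx d T) (a i)) 1))) =
        MvPolynomial.eval (fun ij : Fin d × Fin d => (cmat g * cmat h) ij.1 ij.2)
          (Slice (T + 1) (α i) (γ i)) := by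
      intro i
      rw [← Matrix.mulVec_mulVec, phi_mulVec T (T + 1) le_rfl, phi_mulVec T (T + 1) le_rfl, phi_single,
        map_one, one_mul, piT_piT hcg hch, eval_Slice le_rfl, wgen, ha]
    show (∑ i, f i * coeffQ T (γ i) (hγ i)
      (phi T ((rho T (T + 1) (cmat g) * rho T (T + 1) (cmat h)).mulVec
        (Pi.single (Fintype.equivFin (Idx d T) (a i)) 1)))) = _
    simp_rw [key]
    have ept : (fun ij : Fin d × Fin d =>
        ((((g * h : Matrix.SpecialLinearGroup (Fin d) ℤ) : Matrix (Fin d) (Fin d) ℤ) ij.1 ij.2 : ℤ) : ℂ)) =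
        fun ij : Fin d × Fin d => (cmat g * cmat h) ij.1 ij.2 := by
      funext ij
      rw [← cmat_mul, cmat, Matrix.map_apply, eq_intCast]
    rw [ept, ← eval_red hcgh p, hred, map_sum]
    refine Finset.sum_congr rfl fun i _ => ?_
    rw [MvPolynomial.smul_eq_C_mul, map_mul, eval_C]

/-- **The product model** (stub `stub_productModel` of the line `registered` for the crux
`UnitriangularCostShape`): for every `d ≥ 3`, with `b = k = ⌊d/2⌋` Casimir variables, every budget
`s` admits the truncated oscillator-tower module (`t = (d-1)s + 1`, `N = t^{#q-variables}`) whose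
lifted action `ρ` on `R_t^N` has all polynomials of weighted degree `≤ s` as linear readings of
products `ρ g · ρ h` of upper unitriangular `g, h`. -/
theorem stub_productModel :
    ∀ d : ℕ, 3 ≤ d → ∃ b : ℝ, 0 < b ∧ ∃ k : ℕ, ∃ c : ℝ, 0 < c ∧ ∀ s : ℕ, ∃ t N : ℕ,
      (N : ℝ) ≤ c * ((s : ℝ) + 1) ^ (((d : ℝ) * (d - 1) / 2 - b) / 2) ∧
      (t : ℝ) ^ k ≤ c * ((s : ℝ) + 1) ^ b ∧
      ∃ ρ : Matrix.SpecialLinearGroup (Fin d) ℤ →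
          Matrix (Fin N) (Fin N) (MvPolynomial (Fin k) ℂ ⧸
            Ideal.span (Set.range fun i : Fin k => (MvPolynomial.X i : MvPolynomial (Fin k) ℂ) ^ t)),
        ∀ p : MvPolynomial (Fin d × Fin d) ℂ,
          MvPolynomial.weightedTotalDegree (fun ij : Fin d × Fin d => (ij.2 : ℕ) - ij.1) p ≤ s →
          ∃ ℓ : Matrix (Fin N) (Fin N) (MvPolynomial (Fin k) ℂ ⧸
              Ideal.span (Set.range fun i : Fin k => (MvPolynomial.X i : MvPolynomial (Fin k) ℂ) ^ t))
              →ₗ[ℂ] ℂ,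
            ∀ g h : Matrix.SpecialLinearGroup (Fin d) ℤ,
              (∀ i j : Fin d, j ≤ i → (g : Matrix (Fin d) (Fin d) ℤ) i j = if i = j then 1 else 0) →
              (∀ i j : Fin d, j ≤ i → (h : Matrix (Fin d) (Fin d) ℤ) i j = if i = j then 1 else 0) →
              ℓ (ρ g * ρ h) = MvPolynomial.eval (fun ij : Fin d × Fin d =>
                (((g * h : Matrix.SpecialLinearGroup (Fin d) ℤ) : Matrix (Fin d) (Fin d) ℤ) ij.1 ij.2 : ℂ)) p := by
  intro d hd
  obtain ⟨c, hc, h⟩ := productModel_explicit d hd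
  exact ⟨(d / 2 : ℕ), by exact_mod_cast (show 0 < d / 2 by omega), d / 2, c, hc, h⟩

end Summit.MatrixMultiplication.MatrixMultiplication.Theorems.UnitriangularCostShape
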